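import Mathlib
import Literature.MathematicalPhysics.StatisticalMechanics.Theil2006
import HarnessLib

/-!
# Maximal fluctuation estimates on periodic lattices via quantitative Wulff inequalities (Cicalese–Leonardi 2020)

Topic `Literature/MathematicalPhysics/StatisticalMechanics`; companions: `StickyWulffConstants.lean`,
`FccSurfaceTension.lean`, `WulffCrystalEmergence.lean` (the three-dimensional Wulff-crystal results of
Cicalese–Kreutz–Leonardi 2023 on the fcc and hcp packings), `Theil2006.lean` (the planar triangular
lattice `Theil2006.triangularLattice = ℤ(1,0) ⊕ ℤ(½,√3/2)`, reused below).  Cross-ladder literature-typing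
layer (D-0088 (4)), cell `crystal3d-full`, seat `littype-FC1-2`.

## Source, as printed

M. Cicalese, G. P. Leonardi, *Maximal fluctuations on periodic lattices: an approach via quantitative
Wulff inequalities*, Comm. Math. Phys. **375** (2020) 1931–1944, doi:10.1007/s00220-019-03612-3
[CicaleseLeonardi2020].  Page references are to the 13-page author text held in the hub store as
`paper:doi-10-1007-s00220-019-03612-3` (same numbering of sections, propositions and displays).

* §2 (p. 4–5).  `L ⊂ ℝ^d` the vertex set of a periodic tessellation; `V(x)` the Voronoi cell of `x ∈ L`,
  `V(X) = ⋃_{x∈X} V(x)`; `𝒳_N = {X ⊂ L : #X = N}`; the constrained energy `E_N = E` on `𝒳_N`, `+∞`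
  elsewhere (2.10).  A functional `F` on measurable sets with a unique volume-constrained minimiser `W_v`
  (`|W_v| = v`, `F(W_v) = min{F(D) : |D| = v} > 0`) "satisfies a `ϕ`-quantitative inequality" if
  `inf_x |D △ (x + W_v)| ≤ v ϕ((F(D) − F(W_v))/F(W_v))` for all `D` with `|D| = v` (2.11).
  **Theorem 2.1** (Figalli–Maggi–Pratelli): the anisotropic perimeter `∫_{∂*D} ‖ν‖_W dH^{d−1}` satisfies
  (2.11) with `W_v = v^{1/d} W` and `ϕ(x) = C√x`.
  §2.1: `E_N` is *Q-close* to `F` w.r.t. `ζ : 𝒳_N → 𝓜` and `α_N, β_N, γ_N ≥ 0` if for every `X ∈ 𝒳_N` with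
  `E_N(X) ≤ inf_Y E_N(Y) + α_N` (2.12): `F(ζ(X)) ≤ E_N(X) + β_N` (2.13) and
  `inf_Y E_N(Y) ≤ inf_{|D| = |ζ(X)|} F(D) + γ_N` (2.14).
  **Proposition 1.** "Let `E_N` be Q-close to `F`, assume that `F` satisfies (2.11) and let `X ∈ 𝒳_N` be
  nonempty and such that (2.12) holds. Then, setting `v = |ζ(X)|`,
  `inf_x |ζ(X) △ (x + W_v)| ≤ v ϕ((α_N + β_N + γ_N)/F(W_v))` (2.15)."  (Three-line proof, p. 5.)
* §3 (p. 6), (3.16): for a lattice `L` with unitary edge length, `X ⊂ L`, `x ∈ X`: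
  `val(x, X) = #{y ∈ L ∖ X : |y − x| = 1}`.
* §3.1 *The d-dimensional cubic lattice* (p. 6–7): `L = ℤ^d`, `ζ(X) = ⋃_{x∈X} x + [−½,½]^d`,
  `E(X) = Σ_{x∈X} val(x,X)`, `F = P_1` (the `ℓ¹`-anisotropic perimeter), `W_v = v^{1/d}[−½,½]^d`;
  for `X ∈ 𝒳_N` with (2.12):
  "`inf_x |V(X) △ (x + W_N)| ≤ … ≤ c_d (α_N N^{(d+1)/d} + N^{2−1/d})^{1/2}`.  In particular, in the case
  `α_N = 0` we get `inf_x |V(X) △ (x + W_N)| ≤ c_d N^{1−1/(2d)}`."  ("in dimension 2, we obtain the optimal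
  fluctuation estimate `N^{3/4}`. However, in dimension `d ≥ 3` our method provides a sub-optimal
  fluctuation estimate `N^{1−1/(2d)}`. Indeed … the `N^{3/4}` law has been proved for the lattice `ℤ³` in
  [22]" = Mainini–Piovano–Schmidt–Stefanelli.)
* §3.2 *The honeycomb lattice* (p. 7–8): `L = (ℤv₁ ⊕ ℤv₂) ∪ (e₂ + ℤv₁ ⊕ ℤv₂)`, `v₁ = (√3, 0)`,
  `v₂ = (−√3/2, 3/2)`, `e₂ = (0, 1)` ("each element of `L` has exactly three neighbors at distance 1"; the
  Voronoi cell is an equilateral triangle of area `3√3/4`); `E(X) = √3 Σ_{x∈X} val(x,X)`; `F = P_H`, `H`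
  the regular hexagon "having vertices on the six complex roots of the unity", `H_v` its dilate of area `v`;
  `ζ(X) = V(X)`; (3.21) `inf_x |V(X) △ (x + H_{3√3N/4})| ≤ c₂ (α_N + γ_N)^{1/2} N^{3/4}`, and for `N ≥ 6`,
  `γ_N ≤ 6√3`, whence "`≤ c₁ … (α_N + 6√3)^{1/2} … N^{3/4}`, which proves the `N^{3/4}` law when there
  exists `α > 0` such that `0 ≤ α_N ≤ α` for all `N`."
* §3.3 *The triangular lattice* (p. 8–12): `L = ℤe₁ ⊕ ℤe₂` (unit triangular lattice, see PRINT NOTE),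
  `|V(x)| = √3/2`; `E(X) = ½ Σ_{x∈X} val(x,X)`; `ϕ_x` the `P¹` finite-element basis function of the
  triangular mesh at the node `x` (`ϕ_x(x) = 1`, `ϕ_x = 0` at the other nodes, affine on each closed unit
  triangle), `f_X = Σ_{x∈X} ϕ_x`, `ζ(X) = {f_X > ½}`; **Proposition 2**: `E(X) = ‖∇f_X‖_{L¹} = P_H(ζ(X))`;
  **Proposition 3** (discrete Gauss–Bonnet for `∂ζ(X)`); for `X ∈ 𝒳_N` *connected* with (2.12):
  (3.29) "`inf_x |V(X) △ (x + H_{|ζ(X)|})| ≤ c(α_N + N^{3/4}(√α_N + 1))` where `c > 0` is a fixed constant.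
  This shows the `N^{3/4}` law as soon as one takes `α_N ≤ α` and `X ∈ 𝒳_N` connected."

PRINT NOTE (§3.3).  The held text prints "`e₁ = (0, 1)` and `e₂ = (1/2, √3/2)`", which do not span a unit
triangular lattice (`|e₁ − e₂| ≠ 1`).  The reading consistent with the rest of the section — Proposition 2
(the level segments of `f_X` are parallel to lattice bonds), "regular hexagons of side length `k + 1` can
be obtained as the `ζ`-image of suitable configurations of exactly `N_k` points" (so the Wulff hexagons
`H_v`, whose sides are parallel to those of `H`, have sides along lattice bonds), and `H` with vertices at
the angles `kπ/3` — is `e₁ = (1, 0)`, `e₂ = (½, √3/2)`, i.e. the tree's `Theil2006.triangularLattice`,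
whose bond directions `0, π/3, 2π/3` are the side directions of `H`.  This is the lattice used below.  For
the honeycomb lattice as printed the bond directions are `π/2, 7π/6, 11π/6` and the zigzag (lattice
translation) directions `0, π/3, 2π/3` are again the side directions of `H`; no correction is needed there.
The size of `H` is immaterial in every statement below (only area-normalised dilates `H_v` occur).

## Rendering

* "inf_x |A △ (x + W)|" is `translationDeviation A W = ⨅_a volume (A ∆ (a +ᵥ W))`, an `ℝ≥0∞`; the printed
  real upper bounds `B ≥ 0` are rendered `≤ ENNReal.ofReal B`.
* "`X ∈ 𝒳_N` and `E_N(X) ≤ inf_{Y} E_N(Y) + α_N`" (2.12) is `IsAlmostMinimal L E X α`: `X ⊂ L` and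
  `E X ≤ E Y + α` for every `Y ⊂ L` with `#Y = #X` (equivalent to the printed form, the infimum of a set of
  reals bounded below being its greatest lower bound).
* The constants `c_d, c₂, c` are existentially quantified positive reals, as printed ("a positive constant
  whose value may change from line to line", p. 4); in §3.2 the printed restriction `N ≥ 6` (used for
  `γ_N ≤ 6√3`) is kept.
* "connected" (§3.3, used through the count of the holes of `ζ(X)`): rendered as connectedness of the bond
  graph of `X` (points of `X` at mutual distance `1`), `IsBondConnected` — the reading under which `ζ(X)` is
  connected (adjacent atoms' stars overlap along their common edge, where `f_X = 1 > ½`).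

## Contents (namespace `Literature.MathematicalPhysics.StatisticalMechanics.CicaleseLeonardi2020`)

* vocabulary with bodies: `valence`, `latticeVoronoiCell`, `voronoiRegion`, `translationDeviation`,
  `IsAlmostMinimal`, `IsBondConnected`; `IsQuantitative` (2.11), `IsQClose` (2.12)–(2.14);
  `cubicLattice d = ℤ^d`, `cubicExcess`, `unitCubeAt`, `cubeUnion` (`ζ = V` on `ℤ^d`), `wulffCube d N`;
  `honeycombVec₁/₂`, `honeycombShift`, `honeycombLattice`, `honeycombExcess`; `unitHexagon`, `areaDilate`;
  `triangularExcess`, `neighbourHexagon`, `hatFunction` (`ϕ_x`), `tentFunction` (`f_X`), `zetaSet` (`ζ(X)`)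
  over `Theil2006.triangularLattice`.
* PROVED: `deviation_le_of_isQClose` — Proposition 1, in the abstract form the printed proof uses
  (monotonicity of `ϕ`, `F(W_v) > 0`); `hatFunction_self`, `hatFunction_nonneg` (API of `ϕ_x`).
* NAMED FACTS (published, proved in the source; not re-proved here — D-0014, no `sorry`/axiom):
  `CicaleseLeonardi2020_cubicLattice` (§3.1), `CicaleseLeonardi2020_honeycomb` (§3.2),
  `CicaleseLeonardi2020_triangular` (§3.3, (3.29)); and the proved corollary
  `cubicLattice_minimizers_of` ("in the case `α_N = 0` … `≤ c_d N^{1−1/(2d)}`").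

WHAT IS NOT HERE (gaps, not silently dropped): Theorem 2.1 (= Figalli–Maggi–Pratelli 2010, the sharp
quantitative anisotropic isoperimetric inequality for sets of finite perimeter) — typed SINCE as the named fact
`Literature.Analysis.Convexity.FigalliMaggiPratelli2010_quantitativeWulff` in
`Literature/Analysis/Convexity/QuantitativeWulffInequality.lean`, over the distributional anisotropic perimeter
(`AnisotropicPerimeter.lean`) in place of the reduced boundary, with the PROVED bridge
`isQuantitative_of_quantitativeWulff` to `IsQuantitative` below; Proposition 2's identity `E(X) = P_H(ζ(X))`
(still not typed); the intermediate bounds (3.19)–(3.20), (3.21), (3.24)–(3.28) on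
`γ_N`; the best constants (the source stresses it does not produce them); anything off-lattice or in `d = 3`
beyond `ℤ^d` (the fcc/hcp Wulff shapes are in `FccSurfaceTension.lean` / `WulffCrystalEmergence.lean`; the
source's introduction notes that a lattice version of the sharp quantitative Wulff inequality "seems to be an
interesting question to be investigated in the future", p. 4).
-/

noncomputable section

open scoped Pointwise ENNReal
open MeasureTheory

namespace Literature.MathematicalPhysics.StatisticalMechanics

namespace CicaleseLeonardi2020

/-! ### §2–§3: lattice vocabulary -/

/-- The **valence** of `x` with respect to `X ⊂ L` (3.16): `val(x, X) = #{y ∈ L ∖ X : |y − x| = 1}`, the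
number of nearest-neighbour sites of `x` in the lattice `L` (unitary edge length) left empty by `X`.
[cite: CicaleseLeonardi2020, §3 (3.16), p. 6] -/
def valence {d : ℕ} (L : Set (EuclideanSpace ℝ (Fin d))) (X : Finset (EuclideanSpace ℝ (Fin d)))
    (x : EuclideanSpace ℝ (Fin d)) : ℕ :=
  Set.ncard {y : EuclideanSpace ℝ (Fin d) | y ∈ L ∧ y ∉ X ∧ dist y x = 1}

/-- The **Voronoi cell** of `x` with respect to the point set `L ⊂ ℝ^d`:
`V(x) = {y : |y − x| ≤ |y − z| for all z ∈ L}` (the same formula, for `d = 3`, is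
`Literature.Barriers.AtomisticToContinuum.voronoiCell` of `TetrahedralFrustration.lean`).
[cite: CicaleseLeonardi2020, §2, p. 4] -/
def latticeVoronoiCell {d : ℕ} (L : Set (EuclideanSpace ℝ (Fin d))) (x : EuclideanSpace ℝ (Fin d)) :
    Set (EuclideanSpace ℝ (Fin d)) :=
  {y | ∀ z ∈ L, dist y x ≤ dist y z}

/-- `V(X) = ⋃_{x∈X} V(x)`, the union of the Voronoi cells of the points of `X` ("Voronoi-type set
associated with" `X`, abstract and §2). [cite: CicaleseLeonardi2020, §2, p. 4] -/
def voronoiRegion {d : ℕ} (L : Set (EuclideanSpace ℝ (Fin d))) (X : Finset (EuclideanSpace ℝ (Fin d))) :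
    Set (EuclideanSpace ℝ (Fin d)) :=
  ⋃ x ∈ X, latticeVoronoiCell L x

/-- The **fluctuation of `A` about the shape `W` up to translations**: `inf_{x ∈ ℝ^d} |A △ (x + W)|`
(Lebesgue measure of the symmetric difference), as an extended non-negative real.
[cite: CicaleseLeonardi2020, (2.11), (2.15), p. 5] -/
def translationDeviation {d : ℕ} (A W : Set (EuclideanSpace ℝ (Fin d))) : ℝ≥0∞ :=
  ⨅ a : EuclideanSpace ℝ (Fin d), volume (symmDiff A (a +ᵥ W))

/-- "`X ∈ 𝒳_N` and `E_N(X) ≤ inf_{Y ∈ 𝒳} E_N(Y) + α_N`" (2.12), with `E_N = E` on the `N`-point subsets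
of `L` and `+∞` elsewhere (2.10): `X ⊂ L` and `E(X) ≤ E(Y) + α` for every `Y ⊂ L` with `#Y = #X`.  For
`α = 0`: `X` is an exact energy minimiser among configurations of `#X` lattice points.
[cite: CicaleseLeonardi2020, (2.10), (2.12), p. 5] -/
def IsAlmostMinimal {d : ℕ} (L : Set (EuclideanSpace ℝ (Fin d)))
    (E : Finset (EuclideanSpace ℝ (Fin d)) → ℝ) (X : Finset (EuclideanSpace ℝ (Fin d))) (α : ℝ) : Prop :=
  (↑X : Set (EuclideanSpace ℝ (Fin d))) ⊆ L ∧
    ∀ Y : Finset (EuclideanSpace ℝ (Fin d)), (↑Y : Set (EuclideanSpace ℝ (Fin d))) ⊆ L →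
      Y.card = X.card → E X ≤ E Y + α

/-- `X` is **connected** through nearest-neighbour bonds: any two points of `X` are joined by a chain of
points of `X` with consecutive points at distance exactly `1` (the hypothesis "`X ∈ 𝒳_N` connected" of
§3.3, see the module docstring, Rendering). [cite: CicaleseLeonardi2020, §3.3, p. 10 and p. 12] -/
def IsBondConnected {d : ℕ} (X : Finset (EuclideanSpace ℝ (Fin d))) : Prop :=
  ∀ x ∈ X, ∀ y ∈ X, Relation.ReflTransGen (fun a b => a ∈ X ∧ b ∈ X ∧ dist a b = 1) x y

/-! ### §2: quantitative inequality, quantitative closeness, Proposition 1 (proved) -/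

/-- **`ϕ`-quantitative inequality (2.11)**, abstract form.  `M` is the class of competitors (in the source:
measurable subsets of `ℝ^d`), `vol D = |D|`, `F` the continuum energy, `Fmin v = F(W_v) = min{F(D) : |D| = v}`
and `dev D = inf_x |D △ (x + W_{|D|})|`; the inequality reads `dev D ≤ |D| · ϕ((F(D) − F(W_{|D|}))/F(W_{|D|}))`
for every `D`. [cite: CicaleseLeonardi2020, (2.11), p. 5] -/
def IsQuantitative {M : Type*} (F vol dev : M → ℝ) (Fmin ϕ : ℝ → ℝ) : Prop :=
  ∀ D : M, dev D ≤ vol D * ϕ ((F D - Fmin (vol D)) / Fmin (vol D))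

/-- **Quantitative closeness (§2.1, (2.12)–(2.14))**, abstract form: `E` is the constrained discrete energy
`E_N` on `𝒳 = 𝒳_N`, `m = inf_{Y} E_N(Y)`, `ζ : 𝒳_N → M` the comparison map, and `E_N` is *Q-close* to `F`
with parameters `α, β, γ` if every `X` with `E(X) ≤ m + α` (2.12) satisfies `F(ζ X) ≤ E(X) + β` (2.13) and
`m ≤ F(W_{|ζ X|}) + γ` (2.14) (the source's `inf_{|D| = |ζ(X)|} F(D)` is `F(W_{|ζ(X)|})` by the standing
assumption on `F`). [cite: CicaleseLeonardi2020, §2.1 (2.12)–(2.14), p. 5] -/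
def IsQClose {𝒳 M : Type*} (E : 𝒳 → ℝ) (m : ℝ) (F vol : M → ℝ) (Fmin : ℝ → ℝ) (ζ : 𝒳 → M)
    (α β γ : ℝ) : Prop :=
  ∀ X : 𝒳, E X ≤ m + α → F (ζ X) ≤ E X + β ∧ m ≤ Fmin (vol (ζ X)) + γ

/-- **Proposition 1 (PROVED).** "Let `E_N` be Q-close to `F`, assume that `F` satisfies (2.11) and let
`X ∈ 𝒳_N` be … such that (2.12) holds. Then, setting `v = |ζ(X)|`, the following estimate holds:
`inf_x |ζ(X) △ (x + W_v)| ≤ v ϕ((α_N + β_N + γ_N)/F(W_v))` (2.15)."  The printed proof, verbatim: (2.11),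
then `F(ζ X) − F(W_v) ≤ E_N(X) + β_N − inf E_N + γ_N ≤ α_N + β_N + γ_N` and the monotonicity of the modulus
of continuity `ϕ`; it uses `F(W_v) > 0` and `v ≥ 0`, which are the standing assumptions of §2 and are the
hypotheses `hFmin`, `hvol` here (any real `m` in place of `inf E_N` for which Q-closeness holds will do).
[cite: CicaleseLeonardi2020, Proposition 1 (2.15), p. 5] -/
theorem deviation_le_of_isQClose {𝒳 M : Type*} {E : 𝒳 → ℝ} {m α β γ : ℝ} {F vol dev : M → ℝ}
    {Fmin ϕ : ℝ → ℝ} {ζ : 𝒳 → M} (hϕ : Monotone ϕ) (hquant : IsQuantitative F vol dev Fmin ϕ)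
    (hclose : IsQClose E m F vol Fmin ζ α β γ) {X : 𝒳} (hX : E X ≤ m + α) (hvol : 0 ≤ vol (ζ X))
    (hFmin : 0 < Fmin (vol (ζ X))) :
    dev (ζ X) ≤ vol (ζ X) * ϕ ((α + β + γ) / Fmin (vol (ζ X))) := by
  obtain ⟨h13, h14⟩ := hclose X hX
  refine (hquant (ζ X)).trans (mul_le_mul_of_nonneg_left (hϕ ?_) hvol)
  exact div_le_div_of_nonneg_right (by linarith) hFmin.le

/-! ### §3.1: the `d`-dimensional cubic lattice `ℤ^d` -/

/-- The cubic lattice `ℤ^d ⊂ ℝ^d` (unit edge length). [cite: CicaleseLeonardi2020, §3.1, p. 6] -/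
def cubicLattice (d : ℕ) : Set (EuclideanSpace ℝ (Fin d)) :=
  Set.range fun z : Fin d → ℤ => (WithLp.toLp 2 fun i => (z i : ℝ) : EuclideanSpace ℝ (Fin d))

/-- The Heitmann–Radin excess energy on `ℤ^d`: `E(X) = Σ_{x∈X} val(x, X)` (number of ordered pairs
`(x, y)`, `x ∈ X`, `y ∈ ℤ^d ∖ X`, `|x − y| = 1` — the number of boundary faces of the cube union).
[cite: CicaleseLeonardi2020, §3.1, p. 6] -/
def cubicExcess {d : ℕ} (X : Finset (EuclideanSpace ℝ (Fin d))) : ℕ :=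
  ∑ x ∈ X, valence (cubicLattice d) X x

/-- The closed unit cube `x + [−½, ½]^d` centred at `x` (the Voronoi cell of `x ∈ ℤ^d`).
[cite: CicaleseLeonardi2020, §3.1, p. 6] -/
def unitCubeAt {d : ℕ} (x : EuclideanSpace ℝ (Fin d)) : Set (EuclideanSpace ℝ (Fin d)) :=
  {y | ∀ i, |y i - x i| ≤ 1 / 2}

/-- `ζ(X) = ⋃_{x∈X} (x + [−½, ½]^d)` — for `X ⊂ ℤ^d` this is also the Voronoi-type set `V(X)`, with
`|ζ(X)| = #X`. [cite: CicaleseLeonardi2020, §3.1, p. 6] -/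
def cubeUnion {d : ℕ} (X : Finset (EuclideanSpace ℝ (Fin d))) : Set (EuclideanSpace ℝ (Fin d)) :=
  ⋃ x ∈ X, unitCubeAt x

/-- The Wulff shape of the `ℓ¹`-anisotropic perimeter at volume `N`: the cube `W_N = N^{1/d} [−½, ½]^d`
("the Wulff problem `min_{|D| = v} P_1(D)` has a unique (up to translations and null sets) solution
`W_v = v^{1/d} [−½, ½]^d`"). [cite: CicaleseLeonardi2020, §3.1, p. 6] -/
def wulffCube (d N : ℕ) : Set (EuclideanSpace ℝ (Fin d)) :=
  {y | ∀ i, |y i| ≤ (N : ℝ) ^ ((1 : ℝ) / (d : ℝ)) / 2}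

/-- **Cicalese–Leonardi 2020, §3.1 (fluctuation estimate on `ℤ^d`), NAMED FACT.**  For every `d ≥ 2`
there is `c_d > 0` such that for every `N`, every `α_N ≥ 0` and every `N`-point configuration `X ⊂ ℤ^d`
whose excess energy `E(X) = Σ_x val(x,X)` is within `α_N` of the minimum over `N`-point configurations,
`inf_{x ∈ ℝ^d} |V(X) △ (x + W_N)| ≤ c_d (α_N N^{(d+1)/d} + N^{2 − 1/d})^{1/2}`, where
`V(X) = ⋃_{x∈X} x + [−½,½]^d` and `W_N = N^{1/d}[−½,½]^d`.  (Obtained in the source from Theorem 2.1 =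
the Figalli–Maggi–Pratelli quantitative Wulff inequality for `P_1`, Proposition 1 with `β_N = 0`, and
`γ_N ≤ C_d N^{1−2/d}` (3.20).)  Scope: `ℤ^d` only, `d ≥ 2` (Theorem 2.1 is a statement about `ℝ^d`,
`d ≥ 2`). [cite: CicaleseLeonardi2020, §3.1, displays after (3.20), p. 7] -/
def CicaleseLeonardi2020_cubicLattice : Prop :=
  ∀ d : ℕ, 2 ≤ d → ∃ c : ℝ, 0 < c ∧ ∀ (N : ℕ) (α : ℝ), 0 ≤ α →
    ∀ X : Finset (EuclideanSpace ℝ (Fin d)), X.card = N →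
      IsAlmostMinimal (cubicLattice d) (fun Y => (cubicExcess Y : ℝ)) X α →
        translationDeviation (cubeUnion X) (wulffCube d N) ≤
          ENNReal.ofReal (c * (α * (N : ℝ) ^ (((d : ℝ) + 1) / (d : ℝ)) +
            (N : ℝ) ^ ((2 : ℝ) - 1 / (d : ℝ))) ^ ((1 : ℝ) / 2))

/-- **Corollary for exact minimisers (PROVED from the named fact):** "In particular, in the case `α_N = 0`
we get `inf_x |V(X) △ (x + W_N)| ≤ c_d N^{1 − 1/(2d)}`" — the source's `N^{1−1/(2d)}` law for minimisers of
the edge-isoperimetric problem in `ℤ^d` (optimal, `N^{3/4}`, for `d = 2`; sub-optimal for `d ≥ 3`, where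
the sharp law is again `N^{3/4}`, [22] of the source).
[cite: CicaleseLeonardi2020, §3.1, last display of the subsection, p. 7] -/
theorem cubicLattice_minimizers_of (h : CicaleseLeonardi2020_cubicLattice) {d : ℕ} (hd : 2 ≤ d) :
    ∃ c : ℝ, 0 < c ∧ ∀ (N : ℕ) (X : Finset (EuclideanSpace ℝ (Fin d))), X.card = N →
      IsAlmostMinimal (cubicLattice d) (fun Y => (cubicExcess Y : ℝ)) X 0 →
        translationDeviation (cubeUnion X) (wulffCube d N) ≤
          ENNReal.ofReal (c * (N : ℝ) ^ ((1 : ℝ) - 1 / (2 * (d : ℝ)))) := by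
  obtain ⟨c, hc, hmain⟩ := h d hd
  refine ⟨c, hc, fun N X hcard hmin => ?_⟩
  have key := hmain N 0 le_rfl X hcard hmin
  have hN : (0 : ℝ) ≤ N := Nat.cast_nonneg N
  have hd0 : (d : ℝ) ≠ 0 := by
    have : (0 : ℝ) < d := by exact_mod_cast (lt_of_lt_of_le (by norm_num) hd : 0 < d)
    exact this.ne'
  have e : (0 * (N : ℝ) ^ (((d : ℝ) + 1) / (d : ℝ)) + (N : ℝ) ^ ((2 : ℝ) - 1 / (d : ℝ))) ^ ((1 : ℝ) / 2)
      = (N : ℝ) ^ ((1 : ℝ) - 1 / (2 * (d : ℝ))) := by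
    rw [zero_mul, zero_add, ← Real.rpow_mul hN]
    congr 1
    field_simp
  rwa [e] at key

/-! ### §3.2: the honeycomb lattice -/

/-- `v₁ = (√3, 0)`. [cite: CicaleseLeonardi2020, §3.2, p. 7] -/
def honeycombVec₁ : EuclideanSpace ℝ (Fin 2) := !₂[Real.sqrt 3, 0]

/-- `v₂ = (−√3/2, 3/2)`. [cite: CicaleseLeonardi2020, §3.2, p. 7] -/
def honeycombVec₂ : EuclideanSpace ℝ (Fin 2) := !₂[-(Real.sqrt 3 / 2), 3 / 2]

/-- `e₂ = (0, 1)` (the shift of the second sublattice). [cite: CicaleseLeonardi2020, §3.2, p. 7] -/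
def honeycombShift : EuclideanSpace ℝ (Fin 2) := !₂[0, 1]

/-- The honeycomb lattice `L = (ℤv₁ ⊕ ℤv₂) ∪ (e₂ + ℤv₁ ⊕ ℤv₂)` (bond length `1`, three neighbours per
site). [cite: CicaleseLeonardi2020, §3.2, p. 7] -/
def honeycombLattice : Set (EuclideanSpace ℝ (Fin 2)) :=
  {p | ∃ i j : ℤ, p = (i : ℝ) • honeycombVec₁ + (j : ℝ) • honeycombVec₂} ∪
    {p | ∃ i j : ℤ, p = honeycombShift + (i : ℝ) • honeycombVec₁ + (j : ℝ) • honeycombVec₂}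

/-- The honeycomb excess energy `E(X) = √3 Σ_{x∈X} val(x, X)` ("it coincides with the Heitmann–Radin excess
energy, up to the normalizing factor `√3`"). [cite: CicaleseLeonardi2020, §3.2, p. 7] -/
def honeycombExcess (X : Finset (EuclideanSpace ℝ (Fin 2))) : ℝ :=
  Real.sqrt 3 * ∑ x ∈ X, (valence honeycombLattice X x : ℝ)

/-- The regular hexagon `H` with vertices at the six complex roots of unity `(cos kπ/3, sin kπ/3)`,
`k = 0,…,5` (as a convex hull). [cite: CicaleseLeonardi2020, §3.2, p. 8] -/
def unitHexagon : Set (EuclideanSpace ℝ (Fin 2)) :=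
  convexHull ℝ (Set.range fun k : Fin 6 =>
    !₂[Real.cos ((k : ℕ) * (Real.pi / 3)), Real.sin ((k : ℕ) * (Real.pi / 3))])

/-- The dilate of a planar set `H` of area `v`: `H_v = (v/|H|)^{1/2} H` (so `|H_v| = v` when
`0 < |H| < ∞`); `H_v` is "the solution of [the Wulff problem] having `|H_v| = v`".
[cite: CicaleseLeonardi2020, §3.2, p. 8] -/
def areaDilate (H : Set (EuclideanSpace ℝ (Fin 2))) (v : ℝ) : Set (EuclideanSpace ℝ (Fin 2)) :=
  ((v / (volume H).toReal) ^ ((1 : ℝ) / 2)) • H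

/-- **Cicalese–Leonardi 2020, §3.2 (the `N^{3/4}` law on the honeycomb lattice for almost-minimisers),
NAMED FACT.**  There is `c > 0` such that for every `N ≥ 6`, every `α_N ≥ 0` and every `N`-point
`X ⊂ L` (honeycomb) with `E(X) ≤ inf_{#Y = N} E(Y) + α_N`, `E = √3 Σ val`:
`inf_{x ∈ ℝ²} |V(X) △ (x + H_{3√3N/4})| ≤ c (α_N + 6√3)^{1/2} N^{3/4}`, where `V(X)` is the union of the
Voronoi triangles of the points of `X` (area `3√3N/4`) and `H_v` the regular hexagon with vertices in the
directions `kπ/3` of area `v` — (3.21) combined with the printed bound `γ_N ≤ 6√3` (`N ≥ 6`); "which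
proves the `N^{3/4}` law when there exists `α > 0` such that `0 ≤ α_N ≤ α` for all `N`".  The constant `c`
absorbs the printed numerical factors. [cite: CicaleseLeonardi2020, §3.2, (3.21) and the last display of the
subsection, p. 8] -/
def CicaleseLeonardi2020_honeycomb : Prop :=
  ∃ c : ℝ, 0 < c ∧ ∀ (N : ℕ), 6 ≤ N → ∀ (α : ℝ), 0 ≤ α →
    ∀ X : Finset (EuclideanSpace ℝ (Fin 2)), X.card = N →
      IsAlmostMinimal honeycombLattice honeycombExcess X α →
        translationDeviation (voronoiRegion honeycombLattice X)
            (areaDilate unitHexagon (3 * Real.sqrt 3 * (N : ℝ) / 4)) ≤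
          ENNReal.ofReal (c * (α + 6 * Real.sqrt 3) ^ ((1 : ℝ) / 2) * (N : ℝ) ^ ((3 : ℝ) / 4))

/-! ### §3.3: the triangular lattice -/

/-- The triangular-lattice excess energy `E(X) = ½ Σ_{x∈X} val(x, X)` on
`L = Theil2006.triangularLattice = ℤ(1,0) ⊕ ℤ(½, √3/2)` (see the PRINT NOTE of the module docstring).
[cite: CicaleseLeonardi2020, §3.3, p. 9] -/
def triangularExcess (X : Finset (EuclideanSpace ℝ (Fin 2))) : ℝ :=
  (1 / 2) * ∑ x ∈ X, (valence Theil2006.triangularLattice X x : ℝ)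

/-- The hexagon spanned by the six nearest-neighbour vectors `±e₁, ±e₂, ±(e₂ − e₁)` of the triangular
lattice: the support of the `P¹` basis function at the origin (union of the six closed unit triangles
around `0`). [cite: CicaleseLeonardi2020, §3.3, p. 8–9] -/
def neighbourHexagon : Set (EuclideanSpace ℝ (Fin 2)) :=
  convexHull ℝ {Theil2006.triVec₁, Theil2006.triVec₂, Theil2006.triVec₂ - Theil2006.triVec₁,
    -Theil2006.triVec₁, -Theil2006.triVec₂, Theil2006.triVec₁ - Theil2006.triVec₂}

/-- The `P¹` finite-element basis ("tent") function `ϕ_x` of the triangular mesh at the node `x`: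
`ϕ_x(x) = 1`, `ϕ_x(y) = 0` for the other nodes, affine on every closed unit triangle — written as
`max(0, 1 − g(y − x))` with `g` the gauge (Minkowski functional) of `neighbourHexagon`, which is linear
on each of the six sectors and equals `1` on the hexagon's boundary.
[cite: CicaleseLeonardi2020, §3.3, p. 8–9] -/
def hatFunction (x y : EuclideanSpace ℝ (Fin 2)) : ℝ :=
  max 0 (1 - gauge neighbourHexagon (y - x))

/-- `f_X = Σ_{x∈X} ϕ_x`. [cite: CicaleseLeonardi2020, §3.3, p. 9] -/
def tentFunction (X : Finset (EuclideanSpace ℝ (Fin 2))) (y : EuclideanSpace ℝ (Fin 2)) : ℝ :=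
  ∑ x ∈ X, hatFunction x y

/-- `ζ(X) = {y ∈ ℝ² : f_X(y) > ½}`. [cite: CicaleseLeonardi2020, §3.3, p. 9] -/
def zetaSet (X : Finset (EuclideanSpace ℝ (Fin 2))) : Set (EuclideanSpace ℝ (Fin 2)) :=
  {y | 1 / 2 < tentFunction X y}

/-- `ϕ_x(x) = 1`. [cite: CicaleseLeonardi2020, §3.3, p. 8] -/
theorem hatFunction_self (x : EuclideanSpace ℝ (Fin 2)) : hatFunction x x = 1 := by
  simp [hatFunction, gauge_zero]

/-- `ϕ_x ≥ 0`. [cite: CicaleseLeonardi2020, §3.3, p. 8–9] -/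
theorem hatFunction_nonneg (x y : EuclideanSpace ℝ (Fin 2)) : 0 ≤ hatFunction x y :=
  le_max_left _ _

/-- **Cicalese–Leonardi 2020, §3.3 (3.29) (the `N^{3/4}` law on the triangular lattice for
almost-minimisers), NAMED FACT.**  There is a fixed `c > 0` such that for every `N`, every `α_N ≥ 0` and
every connected `N`-point `X ⊂ L` (unit triangular lattice) with `E(X) ≤ inf_{#Y = N} E(Y) + α_N`,
`E = ½ Σ val`: `inf_{x ∈ ℝ²} |V(X) △ (x + H_{|ζ(X)|})| ≤ c (α_N + N^{3/4}(√α_N + 1))`, where `V(X)` is the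
union of the Voronoi hexagons of the points of `X`, `ζ(X) = {f_X > ½}` and `H_v` is the regular hexagon
with vertices in the directions `kπ/3` of area `v`.  "This shows the `N^{3/4}` law as soon as one takes
`α_N ≤ α` and `X ∈ 𝒳_N` connected."  (Obtained in the source from Proposition 2, Proposition 3, (3.24) and
`γ_N ≤ 9` (3.25)–(3.28).)  See the PRINT NOTE of the module docstring for the coordinates of `L`.
[cite: CicaleseLeonardi2020, §3.3 (3.29), p. 12] -/
def CicaleseLeonardi2020_triangular : Prop :=
  ∃ c : ℝ, 0 < c ∧ ∀ (N : ℕ) (α : ℝ), 0 ≤ α →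
    ∀ X : Finset (EuclideanSpace ℝ (Fin 2)), X.card = N → IsBondConnected X →
      IsAlmostMinimal Theil2006.triangularLattice triangularExcess X α →
        translationDeviation (voronoiRegion Theil2006.triangularLattice X)
            (areaDilate unitHexagon (volume (zetaSet X)).toReal) ≤
          ENNReal.ofReal (c * (α + (N : ℝ) ^ ((3 : ℝ) / 4) * (Real.sqrt α + 1)))

end CicaleseLeonardi2020

end Literature.MathematicalPhysics.StatisticalMechanics

end
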